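import Mathlib
import Summits.CriticalPhenomena.PercolationContinuityZ3.Theorems.PercNearOneGluingNoHeavyLowerTailSunflowerMultiPetalLocalMatching
import HarnessLib
import HarnessLib.Audit

/-!
# `NoHeavyLowerTail` (crux stmt-CriticalPhenomena-4575), abstract sunflower cubic, `k` petals: a LINEAR-ALGEBRA CERTIFICATE SHAPE for the
# multi-petal partition lemma — the rank statement `RankCertificateK` (‼ REFUTED on 6 points, see below) and the reduction `RankCertificateK → PartitionLemmaK`

Support file (seat `prim-l12-p2` gen 28; `--supports stmt-CriticalPhenomena-4575`; companion of `…SunflowerMultiPetal` (p338110: `MSunflower`, `ZK`,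
`PartitionLemmaK`) and `…SunflowerMultiPetalLocalMatching` (p344154: `slotParts`, `badParts`, `ZK_eq_slot : ZK = 6·#slotParts − #badParts`)).  No `sorry`.
Memo: run/shared/lean/prim/prim-l12/prim-l12-p2/FINDING-g28-RANK-CERTIFICATE.md.

CORRECTION (same seat, same session as the first version p349300).  The first version tagged `RankCertificateK` as an `@[conjecture]` on the strength of the EXHAUSTIVE
five-point census (all `(A,B)` on ≤ 5 points, 178 060 instances with rainbows, 0 rank failures).  An adversarial local search on SIX points (work/c/adv7.c) then found
counterexamples within minutes; the first one (kernel = ↑{0123, 0124, 0234, 1234, 015, 125, 135, 0235, 145, 0245, 0345, 2345}, five petal components, three rainbows sharing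
the least block {1}) has certificate rank `#family − 2`, with an explicit ±1 relation of 18 terms — formalised in `…SunflowerMultiPetalRankCertificateRefutation`
(`not_rankCertificateK`).  All four rainbow patterns that survive the five-point census (`(1+x+y)^{F¹}(1+x)^{F³}`, `(1+x+y)^{F¹}(1+x)^{F²}`, and the two with the middle /
least block also carved) fail on six points.  So `RankCertificateK` is kept here only as a plain NAMED STATEMENT (no obligation): the reduction
`partitionLemmaK_of_rankCertificateK` stays a valid (vacuous-hypothesis) theorem and documents the certificate SHAPE; the multi-petal partition lemma `PartitionLemmaK`
and the doubled-cube Hall form `DoubledCubeHallK` (reading (least; middle)) are NOT affected (both hold on every counterexample and exhaustively on ≤ 6 points).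

THE CERTIFICATE SHAPE.  Rows: the ordered 3-partitions `(K | T | R)` of the ground set with `K` DECIDED (top or bottom label), `T` BOTTOM (white) and `R` NOT bottom
(coded as the disjoint pair `(K, R)`, `T = (K ∪ R)ᶜ`; `MSunflower.rowSet`); those with `R` top are exactly the slots (`slotParts_eq`), the others (`R` a petal set)
are the PSEUDO-ROWS.  In `ℚ^{rows}` let `χ^K_U` be the indicator of the rows `(K | T | R)` with spectator exactly `K` and `T ⊆ U`.  Columns:
* a bad ordered partition with a decided block `Q` and petal blocks `P, P'`, `lab P < lab P'`  ↦  `χ^Q_{P'}`  (one-port, carve from the LATER petal);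
* a rainbow `{F¹, F², F³}`, `lab F¹ < lab F² < lab F³`  ↦  `Σ_{K decided, K ⊆ F¹ ∪ F³} χ^K_{F¹ ∖ K}` = indicator of the rows with `K ∩ F² = ∅` and `T ⊆ F¹`
  (= the polynomial `(1+x+y)^{F¹}(1+x)^{F³}` modulo illegal monomials);
* a pseudo-row `(K | T | R)` ↦ `χ^K_T`.
The six orderings of a bad partition carry the same column; they are separated by a position tag in `Fin 6` (`MSunflower.pos`), so the certificate family is indexed by
`badParts ⊕ (pseudoRows × Fin 6)` inside `(rowSet × Fin 6) → ℚ`.  The per-cube part (pairs and pseudo-rows of one spectator `K`) IS linearly independent — it is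
prim-ineq-gen-3's ranked Marica–Schönheim family (the acyclic oriented antipodal Hall theorem); only the rainbow superpositions fail, from six points on.

* `RankCertificateK` (statement (LI); FALSE in general, true for all labellings on ≤ 5 points): the certificate family is linearly independent over `ℚ`.
* `partitionLemmaK_of_rankCertificateK : RankCertificateK → PartitionLemmaK`: `#badParts + 6·#pseudoRows ≤ 6·#rowSet = 6·#slotParts + 6·#pseudoRows`, then `ZK_eq_slot`
  (the counting step that ANY valid certificate of this shape would feed).
-/

namespace Summit.CriticalPhenomena.PercolationContinuityZ3.Theorems.SunflowerPartition

open Finset Module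

namespace MSunflower

variable {α : Type*} [DecidableEq α] [Fintype α] {k : ℕ} (F : MSunflower k α)

/-! ## Rows: `(K | T | R)` with `K` decided, `T` bottom, `R` not bottom, coded `(K, R)` -/

/-- The row index set of the certificate: disjoint pairs `(K, R)` (third block `T = (K ∪ R)ᶜ`) with `lab K` decided, `lab T = 0`, `lab R ≠ 0`. [this work] -/
def rowSet : Finset (Finset α × Finset α) :=
  (parts α).filter fun q => (F.lab q.1 = Fin.last (k + 1) ∨ F.lab q.1 = 0) ∧ F.lab (q.1 ∪ q.2)ᶜ = 0 ∧ F.lab q.2 ≠ 0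

/-- The pseudo-rows: rows whose third block `R` is a petal set. [this work] -/
def pseudoRows : Finset (Finset α × Finset α) :=
  F.rowSet.filter fun q => F.lab q.2 ≠ Fin.last (k + 1)

/-- The slots are exactly the rows whose block `R` is top. [this work] -/
theorem slotParts_eq : F.slotParts = F.rowSet.filter fun q => F.lab q.2 = Fin.last (k + 1) := by
  ext q
  simp only [slotParts, rowSet, mem_filter]
  constructor
  · rintro ⟨hq, hK, hS, hT⟩
    refine ⟨⟨hq, hK, hT, ?_⟩, hS⟩
    rw [hS]
    intro h
    have := congrArg Fin.val h
    simp at this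
  · rintro ⟨⟨hq, hK, hT, -⟩, hS⟩
    exact ⟨hq, hK, hS, hT⟩

/-- `#rowSet = #slotParts + #pseudoRows`. [this work] -/
theorem card_rowSet : #F.rowSet = #F.slotParts + #F.pseudoRows := by
  rw [slotParts_eq, pseudoRows]
  exact (card_filter_add_card_filter_not _).symm

/-! ## Columns -/

/-- A label is decided (top or bottom), as a Boolean. [this work] -/
def isDec (x : Fin (k + 2)) : Bool := decide (x = Fin.last (k + 1) ∨ x = 0)

/-- One-port pair column `χ^Q_{P'}` evaluated at the row `g = (K, R)`: spectator exactly `Q`, carved block `T = (K ∪ R)ᶜ ⊆ P'`. [this work] -/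
def pairVal (Q P' : Finset α) (g : Finset α × Finset α) : ℚ :=
  if g.1 = Q ∧ (g.1 ∪ g.2)ᶜ ⊆ P' then 1 else 0

/-- Rainbow column (least block `Fl` free, middle block `Fm` absorbed, greatest block spectator-or-absorbed) at the row `g = (K, R)`:
`K ∩ Fm = ∅` and `T ⊆ Fl`. [this work] -/
def rbVal (Fl Fm : Finset α) (g : Finset α × Finset α) : ℚ :=
  if Disjoint g.1 Fm ∧ (g.1 ∪ g.2)ᶜ ⊆ Fl then 1 else 0

/-- The column of a bad ordered partition `q = (X, Y)`, `Z = (X ∪ Y)ᶜ` (depends only on the unordered partition): if a block is decided it is the spectator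
and the petal block of larger label is carved; otherwise (rainbow) the blocks are sorted by label. [this work] -/
def colVal (q g : Finset α × Finset α) : ℚ :=
  let X := q.1; let Y := q.2; let Z := (q.1 ∪ q.2)ᶜ
  let x := F.lab X; let y := F.lab Y; let z := F.lab Z
  if isDec (k := k) x then (if y < z then pairVal X Z g else pairVal X Y g)
  else if isDec (k := k) y then (if x < z then pairVal Y Z g else pairVal Y X g)
  else if isDec (k := k) z then (if x < y then pairVal Z Y g else pairVal Z X g)
  else if x < y ∧ x < z then (if y < z then rbVal X Y g else rbVal X Z g)
  else if y < x ∧ y < z then (if x < z then rbVal Y X g else rbVal Y Z g)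
  else (if x < y then rbVal Z X g else rbVal Z Y g)

/-- Position tag separating the six orderings of a bad partition. [this work] -/
def pos (q : Finset α × Finset α) : Fin 6 :=
  let x := F.lab q.1; let y := F.lab q.2; let z := F.lab (q.1 ∪ q.2)ᶜ
  if isDec (k := k) x then (if y < z then 0 else 1)
  else if isDec (k := k) y then (if x < z then 2 else 3)
  else if isDec (k := k) z then (if x < y then 4 else 5)
  else if x < y ∧ y < z then 0 else if x < z ∧ z < y then 1 else if y < x ∧ x < z then 2
  else if y < z ∧ z < x then 3 else if z < x ∧ x < y then 4 else 5

/-- The index type of the certificate family: bad ordered partitions, and pseudo-rows in six copies. [this work] -/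
abbrev CertIndex : Type _ := ↥F.badParts ⊕ (↥F.pseudoRows × Fin 6)

/-- The ambient space: functions on `rowSet × Fin 6`. [this work] -/
abbrev CertSpace : Type _ := (↥F.rowSet × Fin 6) → ℚ

/-- The certificate family. [this work] -/
def certVec : F.CertIndex → F.CertSpace
  | Sum.inl q => fun gi => if gi.2 = F.pos q.1 then F.colVal q.1 gi.1.1 else 0
  | Sum.inr (p, i) => fun gi => if gi.2 = i ∧ gi.1.1.1 = p.1.1 ∧ (gi.1.1.1 ∪ gi.1.1.2)ᶜ ⊆ (p.1.1 ∪ p.1.2)ᶜ then 1 else 0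

end MSunflower

/-- **(LI) rank certificate statement — REFUTED** (this work; FALSE on six points: `…SunflowerMultiPetalRankCertificateRefutation.not_rankCertificateK`; true for
every labelling on ≤ 5 points by exhaustive census).  For every `k`, every finite `α` and every `MSunflower k α` the certificate family `MSunflower.certVec`
(one-port pair columns `χ^Q_{P'}`, rainbow columns `Σ_{K ⊆ F¹∪F³ decided} χ^K_{F¹∖K}`, pseudo columns `χ^K_T`; six tagged copies) is linearly independent over `ℚ`.
Kept as a plain named statement because `partitionLemmaK_of_rankCertificateK` records the (valid) counting reduction. [status: refuted] -/
def RankCertificateK : Prop :=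
  ∀ (k : ℕ) (α : Type) [Fintype α] [DecidableEq α] (F : MSunflower k α), LinearIndependent ℚ F.certVec

/-- **(LI) ⟹ ★ₖ** (valid reduction; the hypothesis is now known to be false in general, see the header): linear independence of the certificate family gives
`#badParts + 6·#pseudoRows ≤ 6·#rowSet = 6·(#slotParts + #pseudoRows)`, hence `#badParts ≤ 6·#slotParts`, i.e. `0 ≤ ZK` by the slot form. [this work] -/
theorem partitionLemmaK_of_rankCertificateK (h : RankCertificateK) : PartitionLemmaK := by
  intro k α _ _ F
  have hli := h k α F
  have hcard := hli.fintype_card_le_finrank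
  rw [Module.finrank_fintype_fun_eq_card, Fintype.card_prod, Fintype.card_sum, Fintype.card_prod, Fintype.card_fin,
    Fintype.card_coe, Fintype.card_coe, Fintype.card_coe] at hcard
  rw [F.ZK_nonneg_iff_card]
  have hrow := F.card_rowSet
  omega

end Summit.CriticalPhenomena.PercolationContinuityZ3.Theorems.SunflowerPartition
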